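import Literature.Probability.LatticeModels.FourFunctionsAEInfinite
import Literature.Probability.LatticeModels.Affiliation

/-!
# On the Hilbert cube an almost-every-pair MTP₂ density need not define an affiliated law

Support file of the Sahi cell (`prim-sahi`; authored by the literature seat gen33 as evidence on
`stmt-CriticalPhenomena-4575`, to be landed by a prover/typer seat).  Theorems only (no definitions, no named
facts, no sorries).

Context.  For FINITE products of σ-finite chains, a density which is MTP₂ on almost every PAIR defines a
set-TP₂, hence affiliated, law (Batty–Bollmann 1980, Prop. 3.4 / Thm. 3.7; tree
`Literature.Probability.LatticeModels.lintegral_four_functions_ae`,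
`Affiliation.mIsAffiliated_withDensity_pi_of_ae`).  Batty–Bollmann's Example 2.3 (tree
`BattyBollmann.example_2_3`, `FourFunctionsAEInfinite.lean`) shows that on the Hilbert cube `[0,1]^ℕ` with product
Lebesgue measure `P` the almost-everywhere FOUR FUNCTIONS theorem fails, through the set `E = limsup {x_n ≤ 1/(n+1)}`
with `P(E) = 1` and `(P ⊗ P){x ∨ y ∈ E} = 0`.  This file records the consequence for DENSITIES that the cell's paper
states: on `[0,1]^ℕ` an a.e.-pair MTP₂ (bounded, measurable) density can have a NEGATIVELY correlated law.  Device
(new, one line): `E` is a down-set of full measure whose pairwise joins are almost never in `E`; so any density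
`ρ` with `1 ≤ ρ ≤ 3`, redefined as the constant `9` on the null set `Eᶜ`, satisfies
`f(x) f(y) ≤ f(x ∧ y) f(x ∨ y)` for almost every pair while `f·P = ρ·P` is arbitrary — here `ρ = 1` on
`{x₀ > ½ ⟺ x₁ > ½}` and `ρ = 3` on its complement, whose law gives the increasing cylinders `A = {x₀ > ½}`,
`B = {x₁ > ½}` the weights `μ(A ∩ B) μ(Ω) = ¼ · 2 < 1 · 1 = μ(A) μ(B)`.

* `exists_aePair_latticeCondition_not_mIsAffiliated` — **there is a measurable `f : (ℕ → I) → [0,∞]`, `f ≤ 9`,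
  MTP₂ on `P ⊗ P`-almost every pair, whose law `P·f` (finite, total mass `2`) is NOT affiliated and NOT set-TP₂;
  indeed two increasing one-coordinate cylinder events are strictly negatively correlated.** [this work]

References: [BattyBollmann1980] C. J. K. Batty, H. W. Bollmann, Z. Wahrsch. verw. Gebiete 53 (1980) 157–173,
Example 2.3 (the set `E`); the density device is not in print (cell literature seat, LITERATURE.md §38).
-/

noncomputable section

namespace Summit.CriticalPhenomena.PercolationContinuityZ3.Theorems.SahiAEHilbertCubeDensity

open MeasureTheory ProbabilityTheory Filter Set unitInterval
open Literature.Probability.LatticeModels Literature.Probability.LatticeModels.Affiliation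
open scoped ENNReal Topology unitInterval

/-- `(n+1)⁻¹ ∈ [0,1]`. [folklore] -/
private theorem inv_succ_mem (n : ℕ) : ((n : ℝ) + 1)⁻¹ ∈ I :=
  ⟨by positivity, inv_le_one_of_one_le₀ (by exact_mod_cast Nat.le_add_left 1 n)⟩

/-- `½ ∈ [0,1]`. [folklore] -/
private theorem half_mem : (2⁻¹ : ℝ) ∈ I := ⟨by norm_num, by norm_num⟩

/-- Batty–Bollmann's full-measure set `E = limsup {x_n ≤ (n+1)⁻¹}` is a down-set: `x ∈ E ⇒ x ∧ y ∈ E`.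
[this work] -/
theorem inf_mem_limsup_of_mem {x : ℕ → I} (y : ℕ → I)
    (hx : x ∈ limsup (fun n => {x : ℕ → I | x n ≤ ⟨((n : ℝ) + 1)⁻¹, inv_succ_mem n⟩}) atTop) :
    x ⊓ y ∈ limsup (fun n => {x : ℕ → I | x n ≤ ⟨((n : ℝ) + 1)⁻¹, inv_succ_mem n⟩}) atTop := by
  simp only [limsup_eq_iInf_iSup_of_nat, iInf_eq_iInter, iSup_eq_iUnion, mem_iInter, mem_iUnion,
    mem_setOf_eq, exists_prop] at hx ⊢
  intro N
  obtain ⟨n, hn, hxn⟩ := hx N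
  exact ⟨n, hn, (inf_le_left : (x ⊓ y) n ≤ x n).trans hxn⟩

/-- **On the Hilbert cube `[0,1]^ℕ` (product Lebesgue measure `P = ⊗_ℕ λ`), a bounded measurable density that is
MTP₂ on ALMOST EVERY PAIR can define a law that is not affiliated, not set-TP₂, and in which two increasing
cylinder events are strictly negatively correlated.**  (Contrast: on every finite product the same hypothesis
forces affiliation, `Affiliation.mIsAffiliated_withDensity_pi_of_ae`.)  Construction: `f = ρ` on Batty–Bollmann's
set `E` (`P(E) = 1`, `(P ⊗ P){x ∨ y ∈ E} = 0`, `E` a down-set) and `f = 9` on `Eᶜ`, with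
`ρ = 1 + 2·𝟙_{(A ∖ B) ∪ (B ∖ A)}`, `A = {x₀ > ½}`, `B = {x₁ > ½}`. [this work] -/
theorem exists_aePair_latticeCondition_not_mIsAffiliated :
    ∃ f : (ℕ → I) → ℝ≥0∞, Measurable f ∧ (∀ x, f x ≤ 9) ∧
      (∀ᵐ p ∂(Measure.infinitePi (fun _ : ℕ => (volume : Measure I))).prod
          (Measure.infinitePi (fun _ : ℕ => (volume : Measure I))),
        f p.1 * f p.2 ≤ f (p.1 ⊓ p.2) * f (p.1 ⊔ p.2)) ∧
      (Measure.infinitePi (fun _ : ℕ => (volume : Measure I))).withDensity f univ = 2 ∧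
      ¬ mIsAffiliated ((Measure.infinitePi (fun _ : ℕ => (volume : Measure I))).withDensity f) ∧
      ¬ mIsSetTP2 ((Measure.infinitePi (fun _ : ℕ => (volume : Measure I))).withDensity f) ∧
      ∃ A B : Set (ℕ → I), MeasurableSet A ∧ MeasurableSet B ∧ IsUpperSet A ∧ IsUpperSet B ∧
        (Measure.infinitePi (fun _ : ℕ => (volume : Measure I))).withDensity f (A ∩ B) *
            (Measure.infinitePi (fun _ : ℕ => (volume : Measure I))).withDensity f univ <
          (Measure.infinitePi (fun _ : ℕ => (volume : Measure I))).withDensity f A *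
            (Measure.infinitePi (fun _ : ℕ => (volume : Measure I))).withDensity f B := by
  classical
  set P := Measure.infinitePi (fun _ : ℕ => (volume : Measure I)) with hP
  set hf : I := ⟨2⁻¹, half_mem⟩ with hhf
  set E := limsup (fun n => {x : ℕ → I | x n ≤ ⟨((n : ℝ) + 1)⁻¹, inv_succ_mem n⟩}) atTop with hE
  -- the two increasing cylinders and the "discordant" set
  set A : Set (ℕ → I) := {x | hf < x 0} with hA
  set B : Set (ℕ → I) := {x | hf < x 1} with hB
  set D : Set (ℕ → I) := (A \ B) ∪ (B \ A) with hD
  have mA : MeasurableSet A := (measurable_pi_apply 0) measurableSet_Ioi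
  have mB : MeasurableSet B := (measurable_pi_apply 1) measurableSet_Ioi
  have mD : MeasurableSet D := (mA.diff mB).union (mB.diff mA)
  have hAu : IsUpperSet A := fun x y hxy hx => lt_of_lt_of_le hx (hxy 0)
  have hBu : IsUpperSet B := fun x y hxy hx => lt_of_lt_of_le hx (hxy 1)
  -- measurability of `E` and the two Batty–Bollmann facts
  have mE : MeasurableSet E :=
    MeasurableSet.measurableSet_limsup fun n => (measurable_pi_apply n) measurableSet_Iic
  have hE1 : P E = 1 := BattyBollmann.infinitePi_limsup_eq_one
  have hEc : P Eᶜ = 0 := by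
    rw [measure_compl mE (measure_ne_top P E), hE1]
    simp [hP]
  have hsup : (P.prod P) {p | p.1 ⊔ p.2 ∈ E} = 0 := BattyBollmann.prod_sup_mem_limsup_eq_zero
  -- the density `ρ = 1 + 2·𝟙_D` and its modification `f`
  set ρ : (ℕ → I) → ℝ≥0∞ := fun x => 1 + D.indicator (fun _ => (2 : ℝ≥0∞)) x with hρ
  have mρ : Measurable ρ := by
    rw [hρ]
    exact (measurable_const (a := (1 : ℝ≥0∞))).add ((measurable_const (a := (2 : ℝ≥0∞))).indicator mD)
  have hρ1 : ∀ x, 1 ≤ ρ x := fun x => le_self_add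
  have hρ3 : ∀ x, ρ x ≤ 3 := by
    intro x
    have : D.indicator (fun _ => (2 : ℝ≥0∞)) x ≤ 2 := by
      by_cases hx : x ∈ D
      · rw [indicator_of_mem hx]
      · rw [indicator_of_notMem hx]; exact zero_le
    calc ρ x = 1 + D.indicator (fun _ => (2 : ℝ≥0∞)) x := rfl
      _ ≤ 1 + 2 := add_le_add le_rfl this
      _ = 3 := by norm_num
  set f : (ℕ → I) → ℝ≥0∞ := E.piecewise ρ (fun _ => 9) with hfd
  have mf : Measurable f := Measurable.piecewise mE mρ measurable_const
  have hf9 : ∀ x, f x ≤ 9 := by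
    intro x
    by_cases hx : x ∈ E
    · rw [hfd, piecewise_eq_of_mem _ _ _ hx]
      exact (hρ3 x).trans (by norm_num)
    · rw [hfd, piecewise_eq_of_notMem _ _ _ hx]
  have hfae : f =ᵐ[P] ρ := by
    have h0 : ∀ᵐ x ∂P, x ∉ Eᶜ := measure_eq_zero_iff_ae_notMem.1 hEc
    filter_upwards [h0] with x hx
    rw [hfd, piecewise_eq_of_mem _ _ _ (show x ∈ E by simpa using hx)]
  have hμ : P.withDensity f = P.withDensity ρ := withDensity_congr_ae hfae
  -- (1) the lattice inequality for almost every pair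
  have hlat : ∀ᵐ p ∂P.prod P, f p.1 * f p.2 ≤ f (p.1 ⊓ p.2) * f (p.1 ⊔ p.2) := by
    have aeE : ∀ᵐ x ∂P, x ∈ E := by
      have h0 : ∀ᵐ x ∂P, x ∉ Eᶜ := measure_eq_zero_iff_ae_notMem.1 hEc
      filter_upwards [h0] with x hx using (show x ∈ E by simpa using hx)
    have a1 : ∀ᵐ p ∂P.prod P, p.1 ∈ E := (Measure.quasiMeasurePreserving_fst (μ := P) (ν := P)).ae aeE
    have a2 : ∀ᵐ p ∂P.prod P, p.2 ∈ E := (Measure.quasiMeasurePreserving_snd (μ := P) (ν := P)).ae aeE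
    have a3 : ∀ᵐ p ∂P.prod P, p.1 ⊔ p.2 ∉ E := measure_eq_zero_iff_ae_notMem.1 hsup
    filter_upwards [a1, a2, a3] with p h1 h2 h3
    have hinf : p.1 ⊓ p.2 ∈ E := inf_mem_limsup_of_mem p.2 h1
    rw [hfd, piecewise_eq_of_mem _ _ _ h1, piecewise_eq_of_mem _ _ _ h2, piecewise_eq_of_mem _ _ _ hinf,
      piecewise_eq_of_notMem _ _ _ h3]
    calc ρ p.1 * ρ p.2 ≤ 3 * 3 := mul_le_mul' (hρ3 _) (hρ3 _)
      _ = 1 * 9 := by norm_num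
      _ ≤ ρ (p.1 ⊓ p.2) * 9 := mul_le_mul' (hρ1 _) le_rfl
  -- (2) the probabilities of the cylinders under `P`
  have q_def : (volume : Measure I) (Ioi hf) = 2⁻¹ := by
    rw [unitInterval.volume_Ioi]
    show ENNReal.ofReal (1 - 2⁻¹) = 2⁻¹
    rw [show (1 : ℝ) - 2⁻¹ = 2⁻¹ by norm_num, ENNReal.ofReal_inv_of_pos two_pos, ENNReal.ofReal_ofNat]
  have q_def' : (volume : Measure I) (Iic hf) = 2⁻¹ := by
    rw [unitInterval.volume_Iic]
    show ENNReal.ofReal 2⁻¹ = 2⁻¹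
    rw [ENNReal.ofReal_inv_of_pos two_pos, ENNReal.ofReal_ofNat]
  set q : ℝ≥0∞ := 2⁻¹ with hq
  have hqq : q + q = 1 := ENNReal.inv_two_add_inv_two
  have hPA : P A = q := by
    have e : A = Set.pi ((({0} : Finset ℕ)) : Set ℕ) (fun _ => Ioi hf) := by ext x; simp [hA]
    rw [e, hP, Measure.infinitePi_pi (fun _ : ℕ => (volume : Measure I)) (fun _ _ => measurableSet_Ioi),
      Finset.prod_singleton, q_def]
  have hPB : P B = q := by
    have e : B = Set.pi ((({1} : Finset ℕ)) : Set ℕ) (fun _ => Ioi hf) := by ext x; simp [hB]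
    rw [e, hP, Measure.infinitePi_pi (fun _ : ℕ => (volume : Measure I)) (fun _ _ => measurableSet_Ioi),
      Finset.prod_singleton, q_def]
  have hPAB : P (A ∩ B) = q * q := by
    have e : A ∩ B = Set.pi ((({0, 1} : Finset ℕ)) : Set ℕ) (fun _ => Ioi hf) := by
      ext x; simp [hA, hB]
    rw [e, hP, Measure.infinitePi_pi (fun _ : ℕ => (volume : Measure I)) (fun _ _ => measurableSet_Ioi),
      Finset.prod_pair zero_ne_one, q_def]
  have hPAdB : P (A \ B) = q * q := by
    have e : A \ B = Set.pi ((({0, 1} : Finset ℕ)) : Set ℕ) (fun i => if i = 0 then Ioi hf else Iic hf) := by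
      ext x; simp [hA, hB, not_lt]
    rw [e, hP, Measure.infinitePi_pi (fun _ : ℕ => (volume : Measure I)) (fun i _ => by
      by_cases hi : i = 0 <;> simp [hi, measurableSet_Ioi, measurableSet_Iic]),
      Finset.prod_pair zero_ne_one]
    simp [q_def, q_def']
  have hPBdA : P (B \ A) = q * q := by
    have e : B \ A = Set.pi ((({0, 1} : Finset ℕ)) : Set ℕ) (fun i => if i = 0 then Iic hf else Ioi hf) := by
      ext x; simp [hA, hB, not_lt]; tauto
    rw [e, hP, Measure.infinitePi_pi (fun _ : ℕ => (volume : Measure I)) (fun i _ => by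
      by_cases hi : i = 0 <;> simp [hi, measurableSet_Ioi, measurableSet_Iic]),
      Finset.prod_pair zero_ne_one]
    simp [q_def, q_def']
  have hPD : P D = q * q + (q * q) := by
    rw [hD, measure_union (Set.disjoint_left.2 fun x hx hy => hy.2 hx.1) (mB.diff mA), hPAdB, hPBdA]
  have hPuniv : P univ = 1 := measure_univ
  -- (3) integrals of `ρ` over cylinders: `∫_T ρ = P(T) + 2 P(D ∩ T)`
  have hint : ∀ {T : Set (ℕ → I)}, MeasurableSet T →
      P.withDensity f T = P T + 2 * P (D ∩ T) := by
    intro T hT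
    rw [hμ, withDensity_apply _ hT, hρ, lintegral_add_left measurable_const, setLIntegral_const, one_mul,
      lintegral_indicator mD, Measure.restrict_restrict mD, setLIntegral_const]
  have h2qq : 2 * (q * q) = q := by rw [two_mul, ← add_mul, hqq, one_mul]
  have hμuniv : P.withDensity f univ = 2 := by
    rw [hint MeasurableSet.univ, inter_univ, hPuniv, hPD, mul_add, h2qq, hqq]
    norm_num
  have hDA : D ∩ A = A \ B := by
    ext x; simp [hD]; tauto
  have hDB : D ∩ B = B \ A := by
    ext x; simp [hD]; tauto
  have hDAB : D ∩ (A ∩ B) = ∅ := by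
    ext x; simp [hD]; tauto
  have hμA : P.withDensity f A = 1 := by
    rw [hint mA, hDA, hPA, hPAdB, h2qq, hqq]
  have hμB : P.withDensity f B = 1 := by
    rw [hint mB, hDB, hPB, hPBdA, h2qq, hqq]
  have hμAB : P.withDensity f (A ∩ B) = q * q := by
    rw [hint (mA.inter mB), hDAB, measure_empty, mul_zero, add_zero, hPAB]
  -- (4) the strict negative correlation
  have hneg : P.withDensity f (A ∩ B) * P.withDensity f univ <
      P.withDensity f A * P.withDensity f B := by
    rw [hμAB, hμuniv, hμA, hμB]
    have e1 : q * q * 2 = q := by rw [mul_comm (q * q) 2, h2qq]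
    have e2 : (1 : ℝ≥0∞) * 1 = 1 := one_mul 1
    rw [e1, e2, hq]
    exact ENNReal.inv_lt_one.2 ENNReal.one_lt_two
  -- (5) not affiliated (take `L = univ`), hence not set-TP₂
  have hnaff : ¬ mIsAffiliated (P.withDensity f) := by
    intro haff
    have := haff MeasurableSet.univ supClosed_univ infClosed_univ mA mB hAu hBu
    simp only [inter_univ] at this
    exact absurd this (not_le.2 (by simpa [mul_comm] using hneg))
  refine ⟨f, mf, hf9, hlat, hμuniv, hnaff, fun h => hnaff h.mIsAffiliated, A, B, mA, mB, hAu, hBu, hneg⟩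

end Summit.CriticalPhenomena.PercolationContinuityZ3.Theorems.SahiAEHilbertCubeDensity

end
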